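import Summits.QuantumFields.BalabanUV.Beta.CompositeVertexKernelUnroll

/-!
# `BalabanUV.Beta.CompositeVertexKernelLiftKernel` — row D1 ∕ (C1) OWNER an2 (gen 60), F6a″: **THE UPPER LIFT OF F6a′ IS THE CONTRACTION WITH THE SHIFTED
# COMPOSITE LINEAR KERNEL**, `liftUp ℓ L k F n μ y = Σ_κ Σ_{z ∈ winF (L^n) (wid L n) y} compLinKer (ℓ ∘ (· + k + 1)) L n (κ, z) (μ, y) · F κ z`, hence the storey unrolling
# of the composite vertex kernel IN KERNEL FORM — the half of «`liftUp`'s transpose» that road FP's (B4) of SPEC-48 reads (W-2 of gen 60, journal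
# `pub-balaban/CLAIMS.log` [AN2-G60-PROPOSED-1]; d1-p3 g36 RCPT-1 l.66960 (c) «the CONTRACTED unrolling … if you type it, (B4) is one `rw`»)

WHAT.  F6a′ (`CompositeVertexKernelUnroll`, p404927 ✓) unrolls `compVHKer ℓ 𝓋 L m` into `Σ_{k<m} liftUp ℓ L k (storeyVH ℓ 𝓋 L k · · f f′) (m−1−k) μ y`, the
upper lift `liftUp` being defined by the same top-peeled recursion as F3's composite linear kernel `compLinKer` (`liftUp_succ` vs `compLinKer_succ`).  This
file identifies the two: the lift of a level-`(k+1)` slot function through the `n` upper bricks `ℓ (k+1), …, ℓ (k+n)` IS the contraction of that function with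
the depth-`n` composite linear kernel of the SHIFTED brick family `fun i ↦ ℓ (k+1+i)`, read from the lower slot `(κ, z)` (as a bond) to the top slot `(μ, y)`,
the lower slot ranging over F3's depth-`n` window `winF (L^n) (wid L n) y` (outside it the kernel vanishes, `compLinKer_eq_zero`).  So the transpose of
`liftUp` that contracts a TOP covector `c` needs no new object: it is `c ↦ Σ_{μ,y} c μ y · compLinKer (ℓ∘(·+k+1)) L n (κ, z) (μ, y)`.
* §1 `sum_winF_zero_indicator` (depth `0`: the window is the point), **`liftUp_eq_sum_compLinKer`** (induction on `n`; window propagation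
  `mem_winF_succ_of_offs` + the support letter `compLinKer_eq_zero` to align the windows, then `Finset.sum_comm`).
* §2 **`compVHKer_unroll_kernel`**: `compVHKer ℓ 𝓋 L m μ y f f′ = Σ_{k<m} Σ_κ Σ_{z ∈ winF (L^{m−1−k}) (wid L (m−1−k)) y} compLinKer (ℓ∘(·+k+1)) L (m−1−k) (κ,z) (μ,y) ·
  storeyVH ℓ 𝓋 L k κ z f f′` (F6a′ + §1), and the finitely-supported-covector contraction `sum_mul_compVHKer_eq` (a top covector on a finite slot set `s` contracted
  with the composite vertex kernel = per storey, the covector pulled back by the shifted composite linear kernel contracted with the storey brick).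
* §3 `mem_piFinset_of_mem_winF`, `summable_of_mem_winF`, `summable_mul_compLinKer_top` (the UPPER window of a fixed lower slot is finite: the `y`-slices of the
  transposed lift are finitely supported — the summability letter the `tsum`-currency contraction will need).
[folklore] finite-sum bookkeeping over OUR objects (F3 `compLinKer`, its windows `winF ∕ wid`, F6a′ `liftUp ∕ storeyVH`); 0 `def`, 0 `def … : Prop`, 0 sorry, nothing cited.
NOT HERE: the `tsum`-currency contraction with a DECAYING top covector (`SLam N (lamCoeffOf (KInv N) N) …`, one Fubini) — follows when SPEC-48 (B1)–(B3) stand.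

HONEST FRAMING (cell charter, verbatim): «discharging `BetaPertH` makes Bałaban's UV stability UNCONDITIONAL — a real constructive-QFT result; it is NOT
the continuum limit and NOT the Clay problem.»  THIS MODULE DISCHARGES NOTHING of row D1; no row of the END wrapper is touched; nothing of Bałaban's asserted.
NOT (C1), NOT D1, NEVER «G-an2-4 closed», NOT BetaPertH, NOT continuum, NOT Clay.
HONEST DEPENDENCY (verbatim): «continuum YM on T⁴ ⇐ BetaPertH ∧ nine spine estimates (0/9 proved); BetaPertH ⇐ (D1) ∧ (D4) ∧ CAP+tail;
G-an2-4 gates asym, D1 and NE2/3/4.»  ABSOLUTE RULE (cell, verbatim): «No internally-minted statement may enter as a cited fact. Every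
hypothesis is either kernel-proved in this package or a verbatim quotation of a PUBLISHED theorem with page reference.»
Unit `b2b-balaban-beta-an2` gen 60 (row-D1 owner), 2026-08-25; `bears_on: R4-O/T1|T1a` (bookkeeping toward the wrapper's `hHN₁`; moves no node counter).  No existing file touched.
-/

noncomputable section

namespace Summit.QuantumFields.BalabanUV.Beta.CompositeVertexKernelLiftKernel

open Finset
open scoped BigOperators
open Literature.MathematicalPhysics.QuantumFieldTheory.Balaban1983to89.Beta
open AffineAveraging (Site)
open AveragingHessianKernels (Bond)
open Summit.QuantumFields.BalabanUV.Beta.CompositeVertexKernelRec (offs compLinKer compVHKer compLinKer_zero compLinKer_succ winF wid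
  mem_winF_zero_iff mem_winF_succ_of_offs compLinKer_eq_zero)
open Summit.QuantumFields.BalabanUV.Beta.CompositeVertexKernelUnroll (storeyVH liftUp liftUp_zero liftUp_succ compVHKer_unroll)

variable {d : ℕ}
variable {ℓ : ℕ → Fin (d + 1) → Site (d + 1) → Bond (d + 1) → ℝ}
  {𝓋 : ℕ → Fin (d + 1) → Site (d + 1) → Bond (d + 1) → Bond (d + 1) → ℝ} {L : ℕ}

/-! ## §1 The upper lift is the contraction with the shifted composite linear kernel -/

/-- [folklore] Depth `0`: the window is the point, and the indicator kernel picks the slot's own value. -/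
theorem sum_winF_zero_indicator (F : Fin (d + 1) → Site (d + 1) → ℝ) (μ : Fin (d + 1)) (y : Site (d + 1)) :
    (∑ κ : Fin (d + 1), ∑ z ∈ winF (L ^ 0) (wid L 0) y,
        (if ((μ, y) : Bond (d + 1)) = (κ, z) then (1 : ℝ) else 0) * F κ z) = F μ y := by
  have hy : y ∈ winF (L ^ 0) (wid L 0) y := mem_winF_zero_iff.2 rfl
  rw [Finset.sum_eq_single μ, Finset.sum_eq_single y, if_pos rfl, one_mul]
  · intro z _ hz
    rw [if_neg (fun h => hz (congrArg Prod.snd h).symm), zero_mul]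
  · intro h
    exact (h hy).elim
  · intro κ _ hκ
    refine Finset.sum_eq_zero fun z _ => ?_
    rw [if_neg (fun h => hκ (congrArg Prod.fst h).symm), zero_mul]
  · intro h
    exact (h (Finset.mem_univ μ)).elim

/-- [folklore] **THE UPPER LIFT IS THE CONTRACTION WITH THE SHIFTED COMPOSITE LINEAR KERNEL**:
`liftUp ℓ L k F n μ y = Σ_κ Σ_{z ∈ winF (L^n) (wid L n) y} compLinKer (fun i ↦ ℓ (k+1+i)) L n (κ, z) (μ, y) · F κ z`. -/
theorem liftUp_eq_sum_compLinKer (k n : ℕ) (F : Fin (d + 1) → Site (d + 1) → ℝ) (μ : Fin (d + 1)) (y : Site (d + 1)) :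
    liftUp ℓ L k F n μ y
      = ∑ κ : Fin (d + 1), ∑ z ∈ winF (L ^ n) (wid L n) y,
          compLinKer (fun i => ℓ (k + 1 + i)) L n (κ, z) (μ, y) * F κ z := by
  induction n generalizing μ y with
  | zero =>
      rw [liftUp_zero]
      simp only [compLinKer_zero]
      exact (sum_winF_zero_indicator F μ y).symm
  | succ n ih =>
      rw [liftUp_succ]
      -- unfold the shifted kernel at depth `n+1` by the top peel, and align the windows
      have hR : ∀ (κ : Fin (d + 1)) (z : Site (d + 1)),
          compLinKer (fun i => ℓ (k + 1 + i)) L (n + 1) (κ, z) (μ, y)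
            = ∑ κ' : Fin (d + 1), ∑ e ∈ offs L, ℓ (k + 1 + n) μ y (κ', (L : ℤ) • y + e)
                * compLinKer (fun i => ℓ (k + 1 + i)) L n (κ, z) (κ', (L : ℤ) • y + e) := fun κ z => by
        rw [compLinKer_succ]
      simp_rw [hR, ih, Finset.mul_sum, Finset.sum_mul]
      -- both sides are now fourfold finite sums; extend the inner windows on the left to the depth-`(n+1)` window of `y`
      have hext : ∀ (κ' : Fin (d + 1)) (e : Site (d + 1)), e ∈ offs L → ∀ κ : Fin (d + 1),
          ∑ z ∈ winF (L ^ n) (wid L n) ((L : ℤ) • y + e),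
              ℓ (k + 1 + n) μ y (κ', (L : ℤ) • y + e) * (compLinKer (fun i => ℓ (k + 1 + i)) L n (κ, z) (κ', (L : ℤ) • y + e) * F κ z)
            = ∑ z ∈ winF (L ^ (n + 1)) (wid L (n + 1)) y,
              ℓ (k + 1 + n) μ y (κ', (L : ℤ) • y + e) * (compLinKer (fun i => ℓ (k + 1 + i)) L n (κ, z) (κ', (L : ℤ) • y + e) * F κ z) := by
        intro κ' e he κ
        refine Finset.sum_subset (fun z hz => mem_winF_succ_of_offs he hz) fun z _ hz => ?_
        rw [compLinKer_eq_zero (ℓ := fun i => ℓ (k + 1 + i)) n (f := (κ, z)) (g := (κ', (L : ℤ) • y + e)) hz, zero_mul, mul_zero]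
      calc (∑ κ' : Fin (d + 1), ∑ e ∈ offs L, ∑ κ : Fin (d + 1), ∑ z ∈ winF (L ^ n) (wid L n) ((L : ℤ) • y + e),
              ℓ (k + 1 + n) μ y (κ', (L : ℤ) • y + e) * (compLinKer (fun i => ℓ (k + 1 + i)) L n (κ, z) (κ', (L : ℤ) • y + e) * F κ z))
          = ∑ κ' : Fin (d + 1), ∑ e ∈ offs L, ∑ κ : Fin (d + 1), ∑ z ∈ winF (L ^ (n + 1)) (wid L (n + 1)) y,
              ℓ (k + 1 + n) μ y (κ', (L : ℤ) • y + e) * (compLinKer (fun i => ℓ (k + 1 + i)) L n (κ, z) (κ', (L : ℤ) • y + e) * F κ z) := by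
            exact Finset.sum_congr rfl fun κ' _ => Finset.sum_congr rfl fun e he => Finset.sum_congr rfl fun κ _ => hext κ' e he κ
        _ = ∑ κ : Fin (d + 1), ∑ z ∈ winF (L ^ (n + 1)) (wid L (n + 1)) y, ∑ κ' : Fin (d + 1), ∑ e ∈ offs L,
              ℓ (k + 1 + n) μ y (κ', (L : ℤ) • y + e) * (compLinKer (fun i => ℓ (k + 1 + i)) L n (κ, z) (κ', (L : ℤ) • y + e) * F κ z) := by
            -- (κ', e, κ, z) ↦ (κ, z, κ', e): four adjacent transpositions
            simp_rw [Finset.sum_comm (s := offs L) (t := (Finset.univ : Finset (Fin (d + 1))))]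
            simp_rw [Finset.sum_comm (s := offs L) (t := winF (L ^ (n + 1)) (wid L (n + 1)) y)]
            rw [Finset.sum_comm]
            exact Finset.sum_congr rfl fun κ _ => Finset.sum_comm
        _ = ∑ κ : Fin (d + 1), ∑ z ∈ winF (L ^ (n + 1)) (wid L (n + 1)) y, ∑ κ' : Fin (d + 1), ∑ e ∈ offs L,
              ℓ (k + 1 + n) μ y (κ', (L : ℤ) • y + e) * compLinKer (fun i => ℓ (k + 1 + i)) L n (κ, z) (κ', (L : ℤ) • y + e) * F κ z := by
            simp only [mul_assoc]

/-! ## §2 The storey unrolling in kernel form; contraction with a finitely supported top covector -/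

/-- [folklore] **THE COMPOSITE VERTEX KERNEL UNROLLED BY STOREY, IN KERNEL FORM**: per storey `k < m`, the storey brick at the lower slot `(κ, z)` transported to
the top slot by the depth-`(m−1−k)` composite linear kernel of the shifted brick family. -/
theorem compVHKer_unroll_kernel (m : ℕ) (μ : Fin (d + 1)) (y : Site (d + 1)) (f f' : Bond (d + 1)) :
    compVHKer ℓ 𝓋 L m μ y f f'
      = ∑ k ∈ range m, ∑ κ : Fin (d + 1), ∑ z ∈ winF (L ^ (m - 1 - k)) (wid L (m - 1 - k)) y,
          compLinKer (fun i => ℓ (k + 1 + i)) L (m - 1 - k) (κ, z) (μ, y) * storeyVH ℓ 𝓋 L k κ z f f' := by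
  rw [compVHKer_unroll]
  exact Finset.sum_congr rfl fun k _ => liftUp_eq_sum_compLinKer k (m - 1 - k) _ μ y

/-- [folklore] **THE CONTRACTED UNROLLING (finitely supported top covector)**: for weights `c` on a finite set `s` of top slots,
`Σ_{σ ∈ s} c σ · compVHKer ℓ 𝓋 L m σ.1 σ.2 f f′ = Σ_{k<m} Σ_{σ ∈ s} Σ_κ Σ_{z ∈ winF (L^{m−1−k}) (wid L (m−1−k)) σ.2} (c σ · compLinKer (ℓ∘(·+k+1)) L (m−1−k) (κ,z) σ) ·
storeyVH ℓ 𝓋 L k κ z f f′` — per storey, the top covector pulled back by the shifted composite linear kernel, contracted with the storey brick. -/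
theorem sum_mul_compVHKer_eq (s : Finset (Fin (d + 1) × Site (d + 1))) (c : Fin (d + 1) × Site (d + 1) → ℝ) (m : ℕ)
    (f f' : Bond (d + 1)) :
    ∑ σ ∈ s, c σ * compVHKer ℓ 𝓋 L m σ.1 σ.2 f f'
      = ∑ k ∈ range m, ∑ σ ∈ s, ∑ κ : Fin (d + 1), ∑ z ∈ winF (L ^ (m - 1 - k)) (wid L (m - 1 - k)) σ.2,
          (c σ * compLinKer (fun i => ℓ (k + 1 + i)) L (m - 1 - k) (κ, z) σ) * storeyVH ℓ 𝓋 L k κ z f f' := by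
  simp_rw [compVHKer_unroll_kernel, Finset.mul_sum, mul_assoc]
  rw [Finset.sum_comm]

/-! ## §3 The upper window of a lower slot is finite (the `y`-range of the transposed lift) -/

/-- [folklore] For a fixed lower site `z` and `0 < N`, the coarse sites `y` whose scale-`N`, width-`W` window contains `z` lie in an explicit finite box:
`z ∈ winF N W y ⟹ y ∈ Π_i Icc ((z_i − W) ∕ N) (z_i ∕ N)`. -/
theorem mem_piFinset_of_mem_winF {N W : ℕ} (hN : 0 < N) {y z : Site (d + 1)} (h : z ∈ winF N W y) :
    y ∈ Fintype.piFinset fun i => Finset.Icc ((z i - (W : ℤ)) / (N : ℤ)) (z i / (N : ℤ)) := by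
  rw [Fintype.mem_piFinset]
  intro i
  obtain ⟨h1, h2⟩ := (Summit.QuantumFields.BalabanUV.Beta.CompositeVertexKernelRec.mem_winF_iff.1 h) i
  have hN' : (0 : ℤ) < (N : ℤ) := by exact_mod_cast hN
  rw [Finset.mem_Icc]
  constructor
  · exact Int.ediv_le_of_le_mul hN' (by linarith [mul_comm (N : ℤ) (y i)])
  · exact Int.le_ediv_of_mul_le hN' (by rw [mul_comm]; exact h1)

/-- [folklore] Hence a function of the coarse site that vanishes unless a FIXED lower site lies in its window is summable (finite support) — the summability
letter of the transposed lift `y ↦ c μ y · compLinKer (ℓ∘(·+k+1)) L n (κ, z) (μ, y)` for fixed `(κ, z)`. -/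
theorem summable_of_mem_winF {N W : ℕ} (hN : 0 < N) (z : Site (d + 1)) {g : Site (d + 1) → ℝ}
    (hg : ∀ y, z ∉ winF N W y → g y = 0) : Summable g :=
  summable_of_ne_finset_zero (s := Fintype.piFinset fun i => Finset.Icc ((z i - (W : ℤ)) / (N : ℤ)) (z i / (N : ℤ)))
    fun y hy => hg y fun h => hy (mem_piFinset_of_mem_winF hN h)

/-- [folklore] The transposed-lift slice is finitely supported in the top site: for fixed `(κ, z)`, `y ↦ w y · compLinKer (ℓ∘(·+k+1)) L n (κ, z) (μ, y)` is summable
for EVERY weight `w` (`0 < L`). -/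
theorem summable_mul_compLinKer_top {L : ℕ} (hL : 0 < L) (k n : ℕ) (w : Site (d + 1) → ℝ) (κ μ : Fin (d + 1)) (z : Site (d + 1)) :
    Summable fun y => w y * compLinKer (fun i => ℓ (k + 1 + i)) L n (κ, z) (μ, y) :=
  summable_of_mem_winF (pow_pos hL n) z fun y hy => by
    rw [compLinKer_eq_zero (ℓ := fun i => ℓ (k + 1 + i)) n (f := (κ, z)) (g := (μ, y)) hy, mul_zero]

end Summit.QuantumFields.BalabanUV.Beta.CompositeVertexKernelLiftKernel

end
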